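import Mathlib
import Literature.Computability.AlgebraicComplexity.EquivariantDC
import Literature.Computability.AlgebraicComplexity.PBoundedGrowth
import Summits.ValiantsHypothesis.ValiantsHypothesis.Statement
import Summits.ValiantsHypothesis.ValiantsHypothesis.Theses.FreeSubtorus
import Summits.ValiantsHypothesis.ValiantsHypothesis.Theorems.FreeSubtorusSubtorusCovering
import Summits.ValiantsHypothesis.ValiantsHypothesis.Theorems.FreeSubtorusConfusionCoveringDefs
import Summits.ValiantsHypothesis.ValiantsHypothesis.Theorems.FreeSubtorusConfusionCoveringKappa
import Summits.ValiantsHypothesis.ValiantsHypothesis.Cruxes.OrbitDimensionBound.Lines.ConfusionLadder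
import Summits.ValiantsHypothesis.ValiantsHypothesis.Cruxes.OrbitDimensionBound.Lines.RowTorusLadder

/-!
# The RANK dial `RankShadow ρ` and its next rung `HalfTorusShadow` (forward unit fwd2-rung-ValiantsHypothesis-01, gen 13)

Crux advanced: `OrbitDimensionBound` (stmt-ValiantsHypothesis-16133) of `route-ValiantsHypothesis-FreeSubtorus`.
FLOOR (seed g1-ValiantsHypothesis-16134, PROVED): `Theorems.FreeSubtorusSubtorusCovering.subtorusCovering_proof :
Theses.FreeSubtorus.SubtorusCovering` — for `n ≥ 3`, a `T_Λ`-equivariant (exact lifts) affine determinantal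
representation of `per_n` of size `m`, `Λ` admissible with `r` generators, has `C(n,⌊n/2⌋) ≤ m · 2^r`.

## The dial (harder as `ρ` grows)

`RankShadow ρ`: along ANY sequence of admissible lattice data `Λ_n` with AT MOST `ρ(n)` GENERATORS and
`T_{Λ_n}`-equivariant affine determinantal representations `B_n` of `per_n` of sizes `m_n` (`n ≥ 3`), the size
`n ↦ m_n` is not p-bounded.  Fewer generators = a bigger torus (`dim T_Λ ≥ 2n - ρ`), so the family is ANTITONE in
`ρ` (`RankShadow.anti`).  Every rung of generations 1–12 of this unit generalised a HYPOTHESIS of the floor while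
keeping the loss `2^r` in the conclusion; this dial moves the CONCLUSION instead: how small may the torus be before
super-polynomiality is lost?  ("I do not know just how large the symmetry group needs to be to obtain an exponential
bound" — Landsberg, *Geometry and complexity theory* (2017), §7.4.1, p. 194.)
* `ρ = ⌊n/2⌋` — IMPLIED BY THE FLOOR (`rankShadow_half_floor`, from `subtorusCovering_proof` by name and
  `C(n,⌊n/2⌋)² · (n+1)² ≥ 4^n`); in fact every `ρ = n - ω(log n)` is inside the floor's (and rung 1
  `ConfusionCovering`'s) reach, since `C(n,⌊n/2⌋)/2^ρ` is then still super-polynomial.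
* `ρ = n - 1` — **THE RUNG `HalfTorusShadow`** (`dim T_Λ ≥ n + 1`, just over HALF of the maximal admissible torus
  `(T^n × T^n)/ℂ^* `of dimension `2n - 1`; the regime of Landsberg–Ressayre's "half the symmetries" Theorem 2.8, but for
  an ARBITRARY admissibly cut subtorus instead of the left factor `T(E)`, and without the monomial part `𝔖_n`).  New
  hard instances at this notch, all of confusion number `≥ C(n,⌊n/2⌋)` (so the floor's weight-class counting returns
  the trivial bound `m ≥ 1`): the CONJUGATION torus `x ↦ D x D⁻¹` (lattice `⟨(e_k - e_l ; e_k - e_l)⟩`, rank `n - 1`),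
  the row torus × column homotheties (`⟨(0 ; e_l - e_{l+1})⟩`, rank `n - 1`; the regime of the registered line
  `RowTorusLadder`, which contains unordered row-set-multilinear ABPs for `per_n`), and their relabelled / partially
  paired mixtures.
* `ρ ≥ 2n - 2` — the torus may shrink to the bi-homotheties `{(λ·1, μ·1)}`; `FullShadow := ∀ ρ, RankShadow ρ` is
  `CoveringShadow 1` of `Lines/ConfusionLadder.lean` (`fullShadow_iff_coveringShadow_one`), i.e. super-polynomial
  determinantal complexity of `per` along bi-graded representations (`VBP ≠ VNP` in equivariant clothing).  The summit
  `S = [VP_ℂ ≠ VNP_ℂ]` implies every member (`rankShadow_of_summit`, via `Confusion.coveringShadow_of_summit`: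
  Berkowitz + VNP-completeness of `per`), so `S` sits above the top of the dial.

## The line (see `Lines/half_torus.lean` for the registered stubs and the kernel-checked composition)

CORE EXTRACTION.  A rank-`≤ n - 1` admissible lattice whose middle confusion number is polynomially close to
`C(n,⌊n/2⌋)` (which the tree's PROVED rung `confusionCovering_kappa : C(n,⌊n/2⌋) ≤ m · κ_{⌊n/2⌋}(Λ)` forces as soon
as `m_n` is p-bounded) contains, after relabelling rows and columns and a diagonal pair sacrifice, a STANDARD CORE of
size `a = ⌊√n⌋`: a one-sided torus (`CoreType.row` / `.col`) or the conjugation torus (`CoreType.conj`) acting on an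
`a × a` block (`CoreDatum`, `Stmt.coreDichotomy` — inverse Littlewood–Offord structure of near-extremal Odlyzko
configurations).  The sacrifice transports the equivariant representation to a core-equivariant representation of
`per_a` of the same size (`Stmt.sacrifice`, the floor's substitution lemmas).  The two terminal statements are the
line's real content: super-polynomiality for the one-sided cores (`Stmt.lineCoreSuperpoly` — the open regime of
`RowTorusLadder`, containing unordered set-multilinear ABP lower bounds for the permanent) and for the conjugation core
(`Stmt.conjCoreSuperpoly` — a NEW object: conjugation-equivariant determinantal complexity of `per`; its finite shadow,
permutation-matrix lifts of the diagonal `𝔖_n`, is exponential by Dawar–Wilsenach, ToC 21 (2025), Cor. 7.12).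
-/

open Matrix MvPolynomial Finset
open Literature.Computability.AlgebraicComplexity
open Summit.ValiantsHypothesis.ValiantsHypothesis.Cruxes.OrbitDimensionBound.Confusion
open Summit.ValiantsHypothesis.ValiantsHypothesis.Theorems.FreeSubtorusConfusionCovering
  (confusionNumber confusionCovering_kappa)

-- the mandated summit-side namespace repeats a component by design (single-problem summit)
set_option linter.dupNamespace false
set_option linter.unusedVariables false

noncomputable section

namespace Summit.ValiantsHypothesis.ValiantsHypothesis.Cruxes.OrbitDimensionBound.Rank

/-! ## §1 The rank dial, its floor member, the rung, the top -/

/-- **The rank dial `RankShadow ρ`.**  Along any sequence `(Λ_n, B_n)` of admissible lattice data with `r_n ≤ ρ(n)`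
generators and `T_{Λ_n}`-equivariant (exact lifts) affine determinantal representations `B_n` of `per_n` of sizes
`m_n` (`n ≥ 3`), the size function `m` is not p-bounded.  The admissibility and equivariance clauses are the floor's,
verbatim. [cite: LandsbergRessayre2017, Thm. 2.8, Question 2.2] -/
def RankShadow (ρ : ℕ → ℕ) : Prop :=
  ∀ (m r : ℕ → ℕ) (Λ : (n : ℕ) → Fin (r n) → (Fin n ⊕ Fin n) → ℤ)
    (B : (n : ℕ) → Matrix (Fin (m n)) (Fin (m n)) (MvPolynomial (Fin n × Fin n) ℂ)),
    (∀ n : ℕ, 3 ≤ n →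
      r n ≤ ρ n ∧
      (∀ i, (∑ k, Λ n i (Sum.inl k)) = 0 ∧ (∑ l, Λ n i (Sum.inr l)) = 0) ∧
      IsEquivariantDetRepr
        (Subgroup.closure {γ : Matrix.GeneralLinearGroup (Fin n × Fin n) ℂ |
          ∃ d e : Fin n → ℂˣ, (∀ i, (∏ k, (d k) ^ (Λ n i (Sum.inl k))) * (∏ l, (e l) ^ (Λ n i (Sum.inr l))) = 1) ∧
            (γ : Matrix (Fin n × Fin n) (Fin n × Fin n) ℂ) = Matrix.diagonal (fun p => (d p.1 : ℂ) * (e p.2 : ℂ))})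
        (perPoly (Fin n) ℂ) (B n)) →
    ¬ IsPBounded m

/-- **THE RUNG `HalfTorusShadow := RankShadow (n - 1)`**: admissible subtori of dimension `≥ n + 1` (at most `n - 1`
relations) force super-polynomial size. [cite: LandsbergRessayre2017, Thm. 2.8, Question 2.2] -/
def HalfTorusShadow : Prop := RankShadow (fun n => n - 1)

/-- The top of the dial: no restriction on the number of relations. [cite: LandsbergRessayre2017, Question 2.2] -/
def FullShadow : Prop := ∀ ρ : ℕ → ℕ, RankShadow ρ

/-- Dial monotonicity (the family is antitone in `ρ`: more allowed relations = smaller tori = harder).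
[folklore] -/
theorem RankShadow.anti {ρ ρ' : ℕ → ℕ} (hle : ∀ n, ρ n ≤ ρ' n) (h : RankShadow ρ') : RankShadow ρ :=
  fun m r Λ B hyp => h m r Λ B fun n hn => ⟨(hyp n hn).1.trans (hle n), (hyp n hn).2⟩

/-- `CoveringShadow 1` (the loss-free shadow of `Lines/ConfusionLadder.lean`) gives every member of the dial.
[folklore] -/
theorem rankShadow_of_coveringShadow_one (h : CoveringShadow (fun _ _ _ => 1)) (ρ : ℕ → ℕ) : RankShadow ρ := by
  intro m r Λ B hyp
  have h' := h m r Λ B (fun n hn => (hyp n hn).2)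
  simpa using h'

/-- The top of the dial IS `CoveringShadow 1`. [folklore] -/
theorem fullShadow_iff_coveringShadow_one : FullShadow ↔ CoveringShadow (fun _ _ _ => 1) := by
  constructor
  · intro h m r Λ B hyp
    have h' := h r m r Λ B (fun n hn => ⟨le_rfl, hyp n hn⟩)
    simpa using h'
  · exact fun h ρ => rankShadow_of_coveringShadow_one h ρ

/-- **ON-PATH, every member: `S → RankShadow ρ`** (Berkowitz + VNP-completeness of `per`, through
`Confusion.coveringShadow_of_summit`). [cite: Burgisser2000, Thm. 2.10, §2.5] -/
theorem rankShadow_of_summit (ρ : ℕ → ℕ) (hS : _root_.ValiantsHypothesis) : RankShadow ρ :=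
  rankShadow_of_coveringShadow_one (coveringShadow_of_summit (fun _ _ _ _ => le_rfl) hS) ρ

/-- **ON-PATH LEMMA `S → HalfTorusShadow`.** [cite: Burgisser2000, Thm. 2.10, §2.5] -/
@[aesop safe apply]
theorem halfTorusShadow_of_summit (hS : _root_.ValiantsHypothesis) : HalfTorusShadow :=
  rankShadow_of_summit _ hS

/-- `S →` the top of the dial. [cite: Burgisser2000, Thm. 2.10, §2.5] -/
theorem fullShadow_of_summit (hS : _root_.ValiantsHypothesis) : FullShadow :=
  fun ρ => rankShadow_of_summit ρ hS

/-- The top gives the rung. [folklore] -/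
theorem halfTorusShadow_of_fullShadow (h : FullShadow) : HalfTorusShadow :=
  h _

/-- `2^n ≤ (n + 1) · C(n, ⌊n/2⌋)`. [folklore] -/
theorem two_pow_le_succ_mul_choose_middle (n : ℕ) : 2 ^ n ≤ (n + 1) * n.choose (n / 2) := by
  rw [← Nat.sum_range_choose n]
  calc ∑ k ∈ Finset.range (n + 1), n.choose k ≤ ∑ _k ∈ Finset.range (n + 1), n.choose (n / 2) :=
        Finset.sum_le_sum fun k _ => Nat.choose_le_middle k n
    _ = (n + 1) * n.choose (n / 2) := by simp

/-- **FLOOR MEMBER.**  The covering rung with loss `2^r` (= the floor `SubtorusCovering`, literally) gives the member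
`ρ = ⌊n/2⌋`: `C(n,⌊n/2⌋) ≤ m_n 2^{⌊n/2⌋}` and `4^n ≤ (n+1)² C(n,⌊n/2⌋)²` give `2^n ≤ (n+1)² m_n²`.
[cite: LandsbergRessayre2017, Thm. 2.8] -/
theorem rankShadow_half_of_coveringRung_powLoss (h : CoveringRung powLoss) : RankShadow (fun n => n / 2) := by
  intro m r Λ B hyp hPB
  have key : ∀ n, 3 ≤ n → 2 ^ n ≤ (n + 1) ^ 2 * (m n * m n) := by
    intro n hn
    obtain ⟨hr, hΛ, hB⟩ := hyp n hn
    have h1 : n.choose (n / 2) ≤ m n * 2 ^ r n := h n hn (m n) (r n) (Λ n) (B n) hΛ hB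
    have h2 : 2 ^ r n ≤ 2 ^ (n / 2) := Nat.pow_le_pow_right (by norm_num) hr
    have h3 := two_pow_le_succ_mul_choose_middle n
    have h4 : 2 ^ (n / 2) * 2 ^ (n / 2) ≤ 2 ^ n := by
      rw [← pow_add]; exact Nat.pow_le_pow_right (by norm_num) (by omega)
    have h5 : n.choose (n / 2) ≤ m n * 2 ^ (n / 2) := h1.trans (Nat.mul_le_mul_left _ h2)
    have h6 : 2 ^ n * 2 ^ n ≤ (n + 1) ^ 2 * (m n * m n) * 2 ^ n :=
      calc 2 ^ n * 2 ^ n ≤ ((n + 1) * n.choose (n / 2)) * ((n + 1) * n.choose (n / 2)) := Nat.mul_le_mul h3 h3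
        _ ≤ ((n + 1) * (m n * 2 ^ (n / 2))) * ((n + 1) * (m n * 2 ^ (n / 2))) :=
          Nat.mul_le_mul (Nat.mul_le_mul_left _ h5) (Nat.mul_le_mul_left _ h5)
        _ = (n + 1) ^ 2 * (m n * m n) * (2 ^ (n / 2) * 2 ^ (n / 2)) := by ring
        _ ≤ (n + 1) ^ 2 * (m n * m n) * 2 ^ n := Nat.mul_le_mul_left _ h4
    exact Nat.le_of_mul_le_mul_right h6 (by positivity)
  exact not_isPBounded_of_two_pow_le 2 3 key (IsPBounded.mul_holds hPB hPB)

/-- **The floor member, from the seed by name.** [cite: LandsbergRessayre2017, Thm. 2.8] -/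
theorem rankShadow_half_floor : RankShadow (fun n => n / 2) :=
  rankShadow_half_of_coveringRung_powLoss
    Summit.ValiantsHypothesis.ValiantsHypothesis.Theorems.FreeSubtorusSubtorusCovering.subtorusCovering_proof

/-! ## §2 The standard cores -/

/-- The three standard core symmetry types on an `a × a` block: one-sided row torus `x ↦ D x`, one-sided column torus
`x ↦ x E`, conjugation torus `x ↦ D x D⁻¹`. -/
inductive CoreType : Type
  | row
  | col
  | conj
  deriving DecidableEq

/-- The core tori of `GL(a²)` (generated subgroups; exact-lift equivariance is w.r.t. their elements).
[cite: LandsbergRessayre2017, §6] [cite: DawarWilsenach2025, §7.4] -/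
def coreTorus (a : ℕ) : CoreType → Subgroup (GL (Fin a × Fin a) ℂ)
  | .row => Subgroup.closure {γ : Matrix.GeneralLinearGroup (Fin a × Fin a) ℂ |
      ∃ t : Fin a → ℂˣ, (γ : Matrix (Fin a × Fin a) (Fin a × Fin a) ℂ) = Matrix.diagonal (fun p => (t p.1 : ℂ))}
  | .col => Subgroup.closure {γ : Matrix.GeneralLinearGroup (Fin a × Fin a) ℂ |
      ∃ t : Fin a → ℂˣ, (γ : Matrix (Fin a × Fin a) (Fin a × Fin a) ℂ) = Matrix.diagonal (fun p => (t p.2 : ℂ))}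
  | .conj => Subgroup.closure {γ : Matrix.GeneralLinearGroup (Fin a × Fin a) ℂ |
      ∃ t : Fin a → ℂˣ, (γ : Matrix (Fin a × Fin a) (Fin a × Fin a) ℂ) =
        Matrix.diagonal (fun p => (t p.1 : ℂ) * ((t p.2)⁻¹ : ℂˣ))}

/-- The row core is the full row torus of `Lines/RowTorusLadder.lean` (`rowTorus a 0 _`). [folklore] -/
theorem coreTorus_row_eq (a : ℕ) : coreTorus a .row = RowTorus.rowTorus a 0 (fun i => i.elim0) := by
  simp [coreTorus, RowTorus.rowTorus]

/-- Exponent vector prescribed to ROW `j` of the core block (in the core's own torus `T^a`). -/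
def blockRow : CoreType → (a : ℕ) → Fin a → Fin a → ℤ
  | .row, _, j => Pi.single j 1
  | .col, _, _ => 0
  | .conj, _, j => Pi.single j 1

/-- Exponent vector prescribed to COLUMN `j` of the core block. -/
def blockCol : CoreType → (a : ℕ) → Fin a → Fin a → ℤ
  | .row, _, _ => 0
  | .col, _, j => Pi.single j 1
  | .conj, _, j => -Pi.single j 1

/-- **`CoreDatum n r Λ a ty`** — the lattice `Λ` CONTAINS A STANDARD CORE of size `a` and type `ty`: after relabelling
rows by `σ` and columns by `τ`, there are exponent vectors `v k, w l ∈ ℤ^a` (the homomorphism `T^a → T^n × T^n`,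
`t ↦ (d, e)`, `d_{σ k} = t^{v k}`, `e_{τ l} = t^{w l}`) such that (i) on the leading `a × a` block the action is the
`N`-th power (`N ≥ 1`; the `N`-th power map of `ℂˣ` is onto, so the image torus is unchanged) of the core action of
type `ty`; (ii) the diagonal pair sacrifice `x_{σ k, τ k} ↦ 1` (`k ≥ a`) has weight `0`; (iii) every relation of `Λ`
holds identically in `t` (the homomorphism lands in `T_Λ`).  The multiple `N` absorbs the denominators of a rational
solution of (i)–(iii). [cite: LandsbergRessayre2017, §6] -/
def CoreDatum (n r : ℕ) (Λ : Fin r → (Fin n ⊕ Fin n) → ℤ) (a : ℕ) (ty : CoreType) : Prop :=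
  a ≤ n ∧ ∃ (N : ℕ) (σ τ : Equiv.Perm (Fin n)) (v w : Fin n → Fin a → ℤ), 0 < N ∧
    (∀ (k : Fin n) (hk : (k : ℕ) < a), v k = N • blockRow ty a ⟨k, hk⟩ ∧ w k = N • blockCol ty a ⟨k, hk⟩) ∧
    (∀ k : Fin n, a ≤ (k : ℕ) → v k + w k = 0) ∧
    (∀ (i : Fin r) (j : Fin a), (∑ k, Λ i (Sum.inl (σ k)) * v k j) + (∑ l, Λ i (Sum.inr (τ l)) * w l j) = 0)

/-! ## §3 Statements of the line's four stubs (registered in `Lines/half_torus.lean`) -/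

/-- Stub 1 (`stub_coreDichotomy`, L): CORE EXTRACTION.  For every exponent `C`, for `n` large, an admissible lattice
with at most `n - 1` generators whose middle confusion number is within the factor `n^C + C` of `C(n,⌊n/2⌋)` contains
a standard core of size `≥ ⌊√n⌋` (inverse Littlewood–Offord: a translate of a subspace holding a polynomial fraction of
the middle layer of the cube is spanned, up to `o(n)` coordinates, by disjoint pair-differences; admissibility and
rank `≤ n - 1` then leave `√n` rows (or columns) free on one side, or `√n` tied pairs).
[cite: Odlyzko1988, p. 127] [cite: LandsbergRessayre2017, §6] -/
def Stmt.coreDichotomy : Prop :=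
  ∀ C : ℕ, ∃ N : ℕ, ∀ n : ℕ, N ≤ n → ∀ (r : ℕ) (Λ : Fin r → (Fin n ⊕ Fin n) → ℤ),
    r ≤ n - 1 → (∀ i, (∑ k, Λ i (Sum.inl k)) = 0 ∧ (∑ l, Λ i (Sum.inr l)) = 0) →
    n.choose (n / 2) ≤ (n ^ C + C) * confusionNumber n r Λ (n / 2) →
    ∃ (ty : CoreType) (a : ℕ), Nat.sqrt n ≤ a ∧ CoreDatum n r Λ a ty

/-- Stub 2 (`stub_sacrifice`, M): the diagonal pair sacrifice `x ↦ diag-embed(X_a) + Σ_{k ≥ a} E_{σ k, τ k}`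
transports a `T_Λ`-equivariant representation of `per_n` to a core-equivariant representation of `per_a` of the same
size (the floor's `stub_substPer` / `stub_substLifts` pattern). [cite: LandsbergRessayre2017, §6] -/
def Stmt.sacrifice : Prop :=
  ∀ (n r a m : ℕ) (Λ : Fin r → (Fin n ⊕ Fin n) → ℤ) (ty : CoreType)
    (B : Matrix (Fin m) (Fin m) (MvPolynomial (Fin n × Fin n) ℂ)),
    CoreDatum n r Λ a ty →
    IsEquivariantDetRepr
      (Subgroup.closure {γ : Matrix.GeneralLinearGroup (Fin n × Fin n) ℂ |
        ∃ d e : Fin n → ℂˣ, (∀ i, (∏ k, (d k) ^ (Λ i (Sum.inl k))) * (∏ l, (e l) ^ (Λ i (Sum.inr l))) = 1) ∧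
          (γ : Matrix (Fin n × Fin n) (Fin n × Fin n) ℂ) = Matrix.diagonal (fun p => (d p.1 : ℂ) * (e p.2 : ℂ))})
      (perPoly (Fin n) ℂ) B →
    ∃ B' : Matrix (Fin m) (Fin m) (MvPolynomial (Fin a × Fin a) ℂ),
      IsEquivariantDetRepr (coreTorus a ty) (perPoly (Fin a) ℂ) B'

/-- Stub 3 (`stub_lineCoreSuperpoly`, L): ONE-SIDED CORES ARE SUPER-POLYNOMIAL — an affine determinantal
representation of `per_a` equivariant (exact lifts) under the full row torus `x ↦ D x` or the full column torus
`x ↦ x E` has size eventually exceeding every power of `a`.  This is the open regime of `Lines/RowTorusLadder.lean`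
(`RowTorusCovering` is its numeric form `C(a,⌊a/2⌋) ≤ m`); it contains super-polynomial lower bounds for unordered
row-set-multilinear ABPs computing `per_a`. [cite: LandsbergRessayre2017, Question 2.2] [cite: Nisan1991]
[cite: ChatterjeeKushSarafShpilka2024, §1] -/
def Stmt.lineCoreSuperpoly : Prop :=
  ∀ K : ℕ, ∃ a₀ : ℕ, ∀ a : ℕ, a₀ ≤ a → ∀ (m : ℕ) (B' : Matrix (Fin m) (Fin m) (MvPolynomial (Fin a × Fin a) ℂ)),
    (IsEquivariantDetRepr (coreTorus a .row) (perPoly (Fin a) ℂ) B' ∨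
      IsEquivariantDetRepr (coreTorus a .col) (perPoly (Fin a) ℂ) B') →
    a ^ K < m

/-- Stub 4 (`stub_conjCoreSuperpoly`, XL — the NEW object): THE CONJUGATION CORE IS SUPER-POLYNOMIAL — an affine
determinantal representation of `per_a` equivariant (exact constant lifts `B(D x D⁻¹) = g_D B(x) h_D⁻¹`) under the
conjugation torus has size eventually exceeding every power of `a`.  Finite shadow known: permutation-matrix lifts of
the diagonal `𝔖_a` force size `2^{Ω(a)}` (Dawar–Wilsenach 2025, Cor. 7.12). [cite: DawarWilsenach2025, Cor. 7.12]
[cite: LandsbergRessayre2017, Question 2.2] -/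
def Stmt.conjCoreSuperpoly : Prop :=
  ∀ K : ℕ, ∃ a₀ : ℕ, ∀ a : ℕ, a₀ ≤ a → ∀ (m : ℕ) (B' : Matrix (Fin m) (Fin m) (MvPolynomial (Fin a × Fin a) ℂ)),
    IsEquivariantDetRepr (coreTorus a .conj) (perPoly (Fin a) ℂ) B' → a ^ K < m

/-! ## §4 Arithmetic of the composition and the link to `RowTorusLadder` -/

/-- Growth: `n^C + C < ⌊√n⌋^{2C+3}` for `n ≥ (4^C (C+2))²`. [folklore] -/
theorem exists_pow_add_lt_sqrt_pow (C : ℕ) :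
    ∃ N : ℕ, ∀ n : ℕ, N ≤ n → n ^ C + C < Nat.sqrt n ^ (2 * C + 3) := by
  refine ⟨(4 ^ C * (C + 2)) ^ 2, fun n hn => ?_⟩
  set s := Nat.sqrt n with hs
  have hs1 : 4 ^ C * (C + 2) ≤ s := Nat.le_sqrt'.2 hn
  have hC1 : 1 ≤ 4 ^ C := Nat.one_le_pow _ _ (by norm_num)
  have hs2 : 2 ≤ s := by
    have : 2 ≤ 4 ^ C * (C + 2) := by nlinarith
    exact this.trans hs1
  have hn4 : n ≤ 4 * s ^ 2 := by
    have h : n < (s + 1) ^ 2 := Nat.lt_succ_sqrt' n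
    have h' : (s + 1) ^ 2 ≤ 4 * s ^ 2 := by nlinarith
    exact h.le.trans h'
  have h1 : n ^ C ≤ 4 ^ C * s ^ (2 * C) := by
    calc n ^ C ≤ (4 * s ^ 2) ^ C := Nat.pow_le_pow_left hn4 C
      _ = 4 ^ C * s ^ (2 * C) := by rw [mul_pow, ← pow_mul]
  have h2 : C ≤ C * s ^ (2 * C) := Nat.le_mul_of_pos_right C (by positivity)
  have h3 : 4 ^ C + C < 4 ^ C * (C + 2) := by nlinarith
  calc n ^ C + C ≤ 4 ^ C * s ^ (2 * C) + C * s ^ (2 * C) := Nat.add_le_add h1 h2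
    _ = (4 ^ C + C) * s ^ (2 * C) := by ring
    _ < 4 ^ C * (C + 2) * s ^ (2 * C) := mul_lt_mul_of_pos_right h3 (by positivity)
    _ ≤ s * s ^ (2 * C) := Nat.mul_le_mul_right _ hs1
    _ = s ^ (2 * C + 1) := by ring
    _ ≤ s ^ (2 * C + 3) := Nat.pow_le_pow_right (by omega) (by omega)

/-- The registered numeric statement `RowTorus.RowTorusCovering` of `Lines/RowTorusLadder.lean` bounds the ROW core:
`C(a,⌊a/2⌋) ≤ m` for `a ≥ 3`. [cite: LandsbergRessayre2017, Question 2.2] -/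
theorem rowCore_bound_of_rowTorusCovering (h : RowTorus.RowTorusCovering) :
    ∀ a : ℕ, 3 ≤ a → ∀ (m : ℕ) (B' : Matrix (Fin m) (Fin m) (MvPolynomial (Fin a × Fin a) ℂ)),
      IsEquivariantDetRepr (coreTorus a .row) (perPoly (Fin a) ℂ) B' → a.choose (a / 2) ≤ m := by
  intro a ha m B' hB'
  rw [coreTorus_row_eq] at hB'
  exact h a ha m B' hB'

/-- **COMPOSITION (kernel-checked): the four stub statements imply the rung.**  If `m` were p-bounded
(`m_n ≤ n^C + C`), the PROVED rung `confusionCovering_kappa` makes every `Λ_n` near-extremal; at a large `n` stub 1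
extracts a core of size `a ≥ ⌊√n⌋`, stub 2 transports `B_n` to it, stubs 3/4 (with `K = 2C + 3`) give
`a^{2C+3} < m_n ≤ n^C + C < ⌊√n⌋^{2C+3} ≤ a^{2C+3}`. [cite: LandsbergRessayre2017, Thm. 2.8, Question 2.2] -/
theorem halfTorusShadow_of_stmts (h1 : Stmt.coreDichotomy) (h2 : Stmt.sacrifice) (h3 : Stmt.lineCoreSuperpoly)
    (h4 : Stmt.conjCoreSuperpoly) : HalfTorusShadow := by
  intro m r Λ B hyp hPB
  obtain ⟨C, hC⟩ := hPB
  obtain ⟨N₁, hN₁⟩ := h1 C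
  obtain ⟨a₃, ha₃⟩ := h3 (2 * C + 3)
  obtain ⟨a₄, ha₄⟩ := h4 (2 * C + 3)
  obtain ⟨N₂, hN₂⟩ := exists_pow_add_lt_sqrt_pow C
  obtain ⟨n, hn_def⟩ : ∃ n : ℕ, n = N₁ + N₂ + (a₃ + a₄) ^ 2 + 9 := ⟨_, rfl⟩
  have hn3 : 3 ≤ n := by omega
  have hN₁n : N₁ ≤ n := by omega
  have hN₂n : N₂ ≤ n := by omega
  have hsq₃ : a₃ ^ 2 ≤ (a₃ + a₄) ^ 2 := Nat.pow_le_pow_left (Nat.le_add_right _ _) 2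
  have hsq₄ : a₄ ^ 2 ≤ (a₃ + a₄) ^ 2 := Nat.pow_le_pow_left (Nat.le_add_left _ _) 2
  have hs₃ : a₃ ≤ Nat.sqrt n := Nat.le_sqrt'.2 (by omega)
  have hs₄ : a₄ ≤ Nat.sqrt n := Nat.le_sqrt'.2 (by omega)
  obtain ⟨hr, hΛ, hB⟩ := hyp n hn3
  have hκ : n.choose (n / 2) ≤ m n * confusionNumber n (r n) (Λ n) (n / 2) :=
    confusionCovering_kappa n hn3 (m n) (r n) (Λ n) (B n) hΛ hB
  have hbig : n.choose (n / 2) ≤ (n ^ C + C) * confusionNumber n (r n) (Λ n) (n / 2) :=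
    hκ.trans (Nat.mul_le_mul_right _ (hC n))
  obtain ⟨ty, a, ha, hcore⟩ := hN₁ n hN₁n (r n) (Λ n) hr hΛ hbig
  obtain ⟨B', hB'⟩ := h2 n (r n) a (m n) (Λ n) ty (B n) hcore hB
  have hlt : a ^ (2 * C + 3) < m n := by
    cases ty with
    | row => exact ha₃ _ (hs₃.trans ha) (m n) B' (Or.inl hB')
    | col => exact ha₃ _ (hs₃.trans ha) (m n) B' (Or.inr hB')
    | conj => exact ha₄ _ (hs₄.trans ha) (m n) B' hB'
  have hgrow : n ^ C + C < a ^ (2 * C + 3) :=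
    (hN₂ n hN₂n).trans_le (Nat.pow_le_pow_left ha _)
  exact absurd (hC n) (not_le.2 (hgrow.trans hlt))

end Summit.ValiantsHypothesis.ValiantsHypothesis.Cruxes.OrbitDimensionBound.Rank

end
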